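import Literature.NumberTheory.LFunctions.GranvilleSoundararajanTwistedMeanSquare
import Literature.NumberTheory.LFunctions.GranvilleSoundararajanEulerProduct
import Literature.NumberTheory.LFunctions.GranvilleSoundararajanLemma23
import Literature.NumberTheory.LFunctions.MertensFormula
import HarnessLib

/-!
# Granville–Soundararajan 2003, Theorem 4: (6.3)–(6.5) and the `α`-integration

Ingredients of the DISCHARGE of the named fact
`Literature.NumberTheory.LFunctions.GranvilleSoundararajan.GranvilleSoundararajan2003_theorem4_central`
(A. Granville, K. Soundararajan, *Decay of mean values of multiplicative functions*, Canad. J. Math.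
55 (2003), Theorem 4, in the form established by §6 of the paper), completed in
`GranvilleSoundararajanTheorem4Proofs.lean`.  With `f₀(n) = f(n) n^{-iy₀}`, `F₀(s) = F(s + iy₀)`
(`LSeries_smoothCut_twist`), `ℓ = log x`:
* (6.4) `exists_norm_F_twist_le`: for a central maximiser `y₀` (`|y₀| ≤ ℓ`, `|F(1+iy)| ≤ |F(1+iy₀)|`
  on `|y| ≤ 2ℓ`), `sup_{|u| ≤ ℓ} |F₀(1+iu)(1 - w^{-iu})| ≤ C₆ ℓ^{2/π} max(log 2w, (log ℓ)²)^{1-2/π}`,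
  from Lemma 2.3 (`GranvilleSoundararajanLemma23`, tree), Mertens' formula (`MertensFormula`, tree)
  and `|1 - w^{-iu}| ≤ min(2, |u| log w)`;
* (6.3) `norm_G_twist_window_le`: transport to `Re s = 1 + α` by (2.6)
  (`GranvilleSoundararajanTwistedPlancherel.norm_LSeries_twist_le_of_bound`) with `T = ℓ/2`, error
  `8e⁵ α` (`∑ |f̃₀(n)|/n ≤ e⁵ ℓ`); (6.5) `norm_G_twist_trivial_le`: `≤ 2(1 + 1/α)`;
* (6.2) `exists_norm_S_sub_le_of_window`: Proposition 3.3 — Lemma 2.1 (2.2) and the kernel step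
  (`GranvilleSoundararajanLemma21Lipschitz`), the twisted (3.8)/Lemma 3.2
  (`GranvilleSoundararajanTwistedMeanSquare`) — integrated over `α ∈ [1/(2ℓ), 1]` with the split at
  `α = 1/A` ("employing (6.4) when `α` is less than … and (6.5) for larger `α`"):
  `‖S(x) - wS(x/w)‖/x · ℓ ≤ 102 A log(2ℓ/A) + 204 A + C_L(log 2ℓ + log 2w · log(ℓ/log 2w) + log 2w)`;
* elementary inequalities for the final bookkeeping (`err_terms_le`, `log_two_mul_div_le`, …).

## References
- [GranvilleSoundararajan2003] A. Granville, K. Soundararajan, *Decay of mean values of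
  multiplicative functions*, Canad. J. Math. 55 (2003), 1191–1230: Lemma 2.2 (2.6), Lemma 2.3,
  Proposition 3.3, §6 (6.1)–(6.5) (arXiv math/9911246 p. 9).

## Design choices
* The twisted function `f₀` is not a new definition: results are stated for any `g` with
  `g(n) = f(n) n^{-iy₀}` as a hypothesis (or any multiplicative `1`-bounded `g : ArithmeticFunction ℂ`).
* All constants are crude, absolute and existential.
-/

noncomputable section

open Finset Real Complex MeasureTheory Set Filter

namespace Literature.NumberTheory.LFunctions

namespace GranvilleSoundararajan

open Halasz (S smoothCut mulLog mulVM smoothCut_of_mem smoothCut_of_not_mem norm_smoothCut_le)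
open MellinPlancherel (psum)

/-! ### The twist factor `1 - w^{-iu}` near `u = 0` -/

/-- `‖1 - w^{-iu}‖ ≤ |u| log w` for real `w ≥ 1` (`|e^{iθ} - 1| ≤ |θ|`).
[cite: GranvilleSoundararajan2003, §6 ("`|1 - w^{-iy}| ≪ min(1, |y| log 2w)`")] -/
theorem norm_one_sub_cpow_neg_mul_I_le_mul {w : ℝ} (hw : 1 ≤ w) (u : ℝ) :
    ‖1 - (w : ℂ) ^ (-((u : ℂ) * I))‖ ≤ |u| * Real.log w := by
  have hw0 : 0 < w := by linarith
  have hw' : (w : ℂ) ≠ 0 := ofReal_ne_zero.mpr hw0.ne'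
  rw [cpow_def_of_ne_zero hw', ← ofReal_log hw0.le]
  have hA : (Real.log w : ℂ) * (-((u : ℂ) * I)) = I * ((-(u * Real.log w) : ℝ) : ℂ) := by
    push_cast; ring
  rw [hA, norm_sub_rev]
  refine (Real.norm_exp_I_mul_ofReal_sub_one_le).trans ?_
  rw [Real.norm_eq_abs, abs_neg, abs_mul, abs_of_nonneg (Real.log_nonneg hw)]

/-! ### The twisted function `f₀(n) = f(n) n^{-iy₀}` and `F₀(s) = F(s + iy₀)` -/

/-- If `g(n) = f(n) n^{-iy₀}` then the smooth truncations satisfy `g̃(n) = f̃(n) n^{-iy₀}`. [folklore] -/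
theorem smoothCut_twist {f g : ℕ → ℂ} {y₀ : ℝ} (hg : ∀ n, g n = f n * (n : ℂ) ^ (-(y₀ * I))) (N n : ℕ) :
    smoothCut g N n = smoothCut f N n * (n : ℂ) ^ (-(y₀ * I)) := by
  by_cases h : n ∈ Nat.smoothNumbers (N + 1)
  · rw [smoothCut_of_mem h, smoothCut_of_mem h, hg]
  · rw [smoothCut_of_not_mem h, smoothCut_of_not_mem h, zero_mul]

/-- **`F₀(s) = F(s + iy₀)`** (GS03 §6): if `g(n) = f(n) n^{-iy₀}` then
`∑ g̃(n) n^{-s} = ∑ f̃(n) n^{-(s + iy₀)}`. [cite: GranvilleSoundararajan2003, §6 (definition of `F₀`)] -/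
theorem LSeries_smoothCut_twist {f g : ℕ → ℂ} {y₀ : ℝ} (hg : ∀ n, g n = f n * (n : ℂ) ^ (-(y₀ * I)))
    (N : ℕ) (s : ℂ) : LSeries (smoothCut g N) s = LSeries (smoothCut f N) (s + y₀ * I) := by
  unfold LSeries
  refine tsum_congr fun n => ?_
  rcases Nat.eq_zero_or_pos n with rfl | hn
  · simp
  · have hn0 : (n : ℂ) ≠ 0 := by exact_mod_cast hn.ne'
    rw [LSeries.term_of_ne_zero hn.ne', LSeries.term_of_ne_zero hn.ne', smoothCut_twist hg,
      Complex.cpow_add _ _ hn0, Complex.cpow_neg]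
    field_simp

/-- The twist `g(n) = f(n) n^{-iy₀}` of a `1`-bounded function is `1`-bounded. [folklore] -/
theorem norm_twist_fun_le {f g : ℕ → ℂ} {y₀ : ℝ} (hg : ∀ n, g n = f n * (n : ℂ) ^ (-(y₀ * I)))
    (hfb : ∀ n, ‖f n‖ ≤ 1) (n : ℕ) : ‖g n‖ ≤ 1 := by
  rw [hg, norm_mul]
  rcases Nat.eq_zero_or_pos n with rfl | hn
  · rcases eq_or_ne (-((y₀ : ℂ) * I)) 0 with h0 | h0
    · rw [h0, cpow_zero, norm_one, mul_one]; exact hfb 0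
    · rw [Nat.cast_zero, zero_cpow h0, norm_zero, mul_zero]; exact zero_le_one
  · have : ‖(n : ℂ) ^ (-((y₀ : ℂ) * I))‖ = 1 := by
      rw [Complex.norm_natCast_cpow_of_pos hn]; simp
    rw [this, mul_one]; exact hfb n

/-! ### (6.4): the supremum of `|F₀(1+iu)(1 - w^{-iu})|` over `|u| ≤ log x` -/

/-- `(max a b)^θ ≤ a^θ + b^θ` for `a, b ≥ 0`. [folklore] -/
theorem max_rpow_le_add {a b : ℝ} (ha : 0 ≤ a) (hb : 0 ≤ b) (θ : ℝ) :
    (max a b) ^ θ ≤ a ^ θ + b ^ θ := by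
  have ha' : 0 ≤ a ^ θ := Real.rpow_nonneg ha θ
  have hb' : 0 ≤ b ^ θ := Real.rpow_nonneg hb θ
  rcases le_total a b with h | h
  · rw [max_eq_right h]; linarith
  · rw [max_eq_left h]; linarith

/-- **Granville–Soundararajan (6.4), the pointwise form.**  There is an absolute `C₆ > 0` such that
for every multiplicative `f` with `|f| ≤ 1`, `x ≥ 3` (`ℓ = log x`), every `y₀` with `|y₀| ≤ ℓ` at
which `|F(1+iy)|` is maximal over `|y| ≤ 2ℓ`, every `1 ≤ w ≤ x` and every `|u| ≤ ℓ`,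
`|F(1 + i(y₀+u))| · |1 - w^{-iu}| ≤ C₆ ℓ^{2/π} max(log 2w, (log ℓ)²)^{1-2/π}`
(for `|u| ≤ 1/ℓ` by Mertens and `|1 - w^{-iu}| ≤ |u| log w`; for `1/ℓ ≤ |u| ≤ ℓ` by
`|F(1+i(y₀+u))|² ≤ |F(1+iy₀) F(1+i(y₀+u))|` and Lemma 2.3, with `|1 - w^{-iu}| ≤ min(2, |u| log w)`).
[cite: GranvilleSoundararajan2003, §6, (6.1) and (6.4)] -/
theorem exists_norm_F_twist_le :
    ∃ C₆ : ℝ, 0 < C₆ ∧ ∀ (f : ArithmeticFunction ℂ), f.IsMultiplicative → (∀ n, ‖f n‖ ≤ 1) →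
      ∀ x : ℝ, 3 ≤ x → ∀ y₀ : ℝ, |y₀| ≤ Real.log x →
        (∀ y : ℝ, |y| ≤ 2 * Real.log x →
          ‖truncEulerProduct f x (1 + y * I)‖ ≤ ‖truncEulerProduct f x (1 + y₀ * I)‖) →
        ∀ w : ℝ, 1 ≤ w → w ≤ x → ∀ u : ℝ, |u| ≤ Real.log x →
          ‖truncEulerProduct f x (1 + (y₀ + u) * I)‖ * ‖1 - (w : ℂ) ^ (-((u : ℂ) * I))‖ ≤
            C₆ * Real.log x ^ (2 / Real.pi) *
              (max (Real.log (2 * w)) (Real.log (Real.log x) ^ 2)) ^ (1 - 2 / Real.pi) := by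
  obtain ⟨C₂₃, hC₂₃⟩ := GranvilleSoundararajan2003_lemma23_holds
  obtain ⟨C_M, hC_M⟩ := Mertens.mertens_formula
  set θ : ℝ := 1 - 2 / Real.pi with hθ
  have hπ3 : (3 : ℝ) < Real.pi := Real.pi_gt_three
  have hθ0 : 0 < θ := by
    rw [hθ, sub_pos, div_lt_one Real.pi_pos]; linarith
  have hθ1 : θ ≤ 1 := by
    have : (0 : ℝ) ≤ 2 / Real.pi := by positivity
    rw [hθ]; linarith
  have h2π0 : 0 < 2 / Real.pi := by positivity
  have h2π1 : 2 / Real.pi ≤ 1 := by rw [div_le_one Real.pi_pos]; linarith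
  -- the constant of Lemma 2.3 may be taken `≥ 0`
  set C' : ℝ := max C₂₃ 0 with hC'
  have hC'0 : 0 ≤ C' := le_max_right _ _
  set K : ℝ := 2 * (2 + |C_M|) + 2 * Real.sqrt C' + 1 with hK
  refine ⟨K, by positivity, ?_⟩
  intro f hf hfb x hx y₀ hy₀ hmax w hw hwx u hu
  set ℓ : ℝ := Real.log x with hℓ
  set Lw : ℝ := Real.log (2 * w) with hLw
  set M : ℝ := max Lw (Real.log ℓ ^ 2) with hM
  have hx0 : 0 < x := by linarith
  have hw0 : 0 < w := by linarith
  have hℓ1 : 1 < ℓ := by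
    rw [hℓ, Real.lt_log_iff_exp_lt hx0]
    exact lt_of_lt_of_le (by have := Real.exp_one_lt_d9; linarith) hx
  have hℓ0 : 0 < ℓ := by linarith
  have hlog2 : (0.69 : ℝ) < Real.log 2 := by have := Real.log_two_gt_d9; linarith
  have hLw0 : 0 < Lw := by rw [hLw]; exact Real.log_pos (by linarith)
  have hLwle : Lw ≤ 2 * ℓ := by
    have h1 : Real.log 2 ≤ ℓ := by rw [hℓ]; exact Real.log_le_log (by norm_num) (by linarith)
    have h2 : Real.log w ≤ ℓ := by rw [hℓ]; exact Real.log_le_log hw0 hwx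
    rw [hLw, Real.log_mul (by norm_num) hw0.ne']; linarith
  have hM0 : 0 < M := lt_max_of_lt_left hLw0
  have hLwM : Lw ≤ M := le_max_left _ _
  have hllM : Real.log ℓ ^ 2 ≤ M := le_max_right _ _
  have hMθ0 : 0 ≤ M ^ θ := Real.rpow_nonneg hM0.le θ
  have hℓθ0 : 0 < ℓ ^ (2 / Real.pi) := Real.rpow_pos_of_pos hℓ0 _
  -- `Lw ≤ 2 ℓ^{2/π} M^θ`
  have hLw_le : Lw ≤ 2 * ℓ ^ (2 / Real.pi) * M ^ θ := by
    have e1 : Lw = Lw ^ (2 / Real.pi) * Lw ^ θ := by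
      rw [← Real.rpow_add hLw0, hθ]; norm_num
    have e2 : Lw ^ (2 / Real.pi) ≤ (2 * ℓ) ^ (2 / Real.pi) := Real.rpow_le_rpow hLw0.le hLwle h2π0.le
    have e3 : (2 * ℓ) ^ (2 / Real.pi) ≤ 2 * ℓ ^ (2 / Real.pi) := by
      rw [Real.mul_rpow (by norm_num) hℓ0.le]
      gcongr
      calc (2 : ℝ) ^ (2 / Real.pi) ≤ 2 ^ (1 : ℝ) := Real.rpow_le_rpow_of_exponent_le (by norm_num) h2π1
        _ = 2 := Real.rpow_one 2
    have e4 : Lw ^ θ ≤ M ^ θ := Real.rpow_le_rpow hLw0.le hLwM hθ0.le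
    calc Lw = Lw ^ (2 / Real.pi) * Lw ^ θ := e1
      _ ≤ (2 * ℓ ^ (2 / Real.pi)) * M ^ θ :=
          mul_le_mul (e2.trans e3) e4 (Real.rpow_nonneg hLw0.le θ) (by positivity)
      _ = 2 * ℓ ^ (2 / Real.pi) * M ^ θ := by ring
  -- the twist factor
  have htw1 := norm_one_sub_cpow_neg_mul_I_le_mul hw u
  have htw2 := norm_one_sub_cpow_neg_mul_I_le hw u
  have hlogw : Real.log w ≤ Lw := by rw [hLw]; exact Real.log_le_log hw0 (by linarith)
  have hlogw0 : 0 ≤ Real.log w := Real.log_nonneg hw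
  have hKge1 : 2 * (2 + |C_M|) ≤ K := by rw [hK]; have := Real.sqrt_nonneg C'; linarith
  have hKge2 : 2 * Real.sqrt C' ≤ K := by rw [hK]; have := abs_nonneg C_M; linarith
  have hF0 : 0 ≤ ‖truncEulerProduct (⇑f) x (1 + (y₀ + u) * I)‖ := norm_nonneg _
  by_cases hsmall : |u| < 1 / ℓ
  · -- `|u| < 1/ℓ`: Mertens
    have hP := norm_truncEulerProduct_one_line_le hfb x (y₀ + u)
    have hMert := (abs_le.mp (hC_M x (by linarith))).2
    have heγ : Real.exp Real.eulerMascheroniConstant < 2 := by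
      have h1 := Real.eulerMascheroniConstant_lt_two_thirds
      have h2 := Real.log_two_gt_d9
      calc Real.exp Real.eulerMascheroniConstant < Real.exp (Real.log 2) := Real.exp_lt_exp.mpr (by linarith)
        _ = 2 := Real.exp_log (by norm_num)
    have hFle : ‖truncEulerProduct (⇑f) x (1 + (y₀ + u) * I)‖ ≤ (2 + |C_M|) * ℓ := by
      have h1 : Real.exp Real.eulerMascheroniConstant * Real.log x ≤ 2 * ℓ := by
        rw [hℓ]; exact mul_le_mul_of_nonneg_right heγ.le hℓ0.le
      have h2 : C_M ≤ |C_M| * ℓ := by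
        calc C_M ≤ |C_M| := le_abs_self _
          _ = |C_M| * 1 := (mul_one _).symm
          _ ≤ |C_M| * ℓ := mul_le_mul_of_nonneg_left hℓ1.le (abs_nonneg _)
      push_cast at hP
      nlinarith
    have hul : |u| * Real.log w ≤ 1 / ℓ * Lw := mul_le_mul hsmall.le hlogw hlogw0 (by positivity)
    calc ‖truncEulerProduct (⇑f) x (1 + (y₀ + u) * I)‖ * ‖1 - (w : ℂ) ^ (-((u : ℂ) * I))‖
        ≤ ((2 + |C_M|) * ℓ) * (1 / ℓ * Lw) := mul_le_mul hFle (htw1.trans hul) (norm_nonneg _) (by positivity)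
      _ = (2 + |C_M|) * Lw := by field_simp
      _ ≤ (2 + |C_M|) * (2 * ℓ ^ (2 / Real.pi) * M ^ θ) := mul_le_mul_of_nonneg_left hLw_le (by positivity)
      _ = (2 * (2 + |C_M|)) * ℓ ^ (2 / Real.pi) * M ^ θ := by ring
      _ ≤ K * ℓ ^ (2 / Real.pi) * M ^ θ := by gcongr
  · -- `1/ℓ ≤ |u| ≤ ℓ`: Lemma 2.3
    push Not at hsmall
    have hu0 : 0 < |u| := lt_of_lt_of_le (by positivity) hsmall
    set mx : ℝ := max (1 / |u|) (Real.log ℓ ^ 2) with hmx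
    have hmx0 : 0 < mx := lt_max_of_lt_left (by positivity)
    have h23 := hC₂₃ f hf hfb x hx y₀ u hsmall hu
    rw [← hℓ] at h23
    have hyu : |y₀ + u| ≤ 2 * Real.log x := by rw [← hℓ]; exact (abs_add_le y₀ u).trans (by linarith)
    have hmaxu := hmax (y₀ + u) hyu
    push_cast at hmaxu
    -- `‖F(1+i(y₀+u))‖² ≤ C' ℓ^{4/π} mx^{2θ}`
    have hsq : ‖truncEulerProduct (⇑f) x (1 + (y₀ + u) * I)‖ ^ 2 ≤ C' * ℓ ^ (4 / Real.pi) * mx ^ (2 * θ) := by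
      have h1 : ‖truncEulerProduct (⇑f) x (1 + (y₀ + u) * I)‖ ^ 2 ≤
          ‖truncEulerProduct (⇑f) x (1 + y₀ * I) * truncEulerProduct (⇑f) x (1 + (y₀ + u) * I)‖ := by
        rw [norm_mul, sq]
        exact mul_le_mul_of_nonneg_right hmaxu (norm_nonneg _)
      have h2 : C₂₃ * ℓ ^ (4 / Real.pi) * mx ^ (2 * θ) ≤ C' * ℓ ^ (4 / Real.pi) * mx ^ (2 * θ) := by
        gcongr; exact le_max_left _ _
      have h23' : ‖truncEulerProduct (⇑f) x (1 + y₀ * I) * truncEulerProduct (⇑f) x (1 + (y₀ + u) * I)‖ ≤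
          C₂₃ * ℓ ^ (4 / Real.pi) * mx ^ (2 * θ) := by
        simpa only [hmx, hθ] using h23
      linarith
    -- take square roots
    set b : ℝ := Real.sqrt C' * ℓ ^ (2 / Real.pi) * mx ^ θ with hb
    have hb0 : 0 ≤ b := by positivity
    have hbsq : b ^ 2 = C' * ℓ ^ (4 / Real.pi) * mx ^ (2 * θ) := by
      rw [hb, mul_pow, mul_pow, Real.sq_sqrt hC'0, ← Real.rpow_natCast (ℓ ^ (2 / Real.pi)) 2,
        ← Real.rpow_mul hℓ0.le, ← Real.rpow_natCast (mx ^ θ) 2, ← Real.rpow_mul hmx0.le]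
      congr 2 <;> push_cast <;> ring
    have hFle : ‖truncEulerProduct (⇑f) x (1 + (y₀ + u) * I)‖ ≤ b := by
      refine le_of_pow_le_pow_left₀ two_ne_zero hb0 ?_
      rw [hbsq]; exact hsq
    by_cases hcase : |u| * Lw ≤ 1
    · -- `|u| Lw ≤ 1`: use `|1 - w^{-iu}| ≤ |u| log w`
      have hmxθ : mx ^ θ ≤ (1 / |u|) ^ θ + (Real.log ℓ ^ 2) ^ θ :=
        max_rpow_le_add (by positivity) (by positivity) θ
      -- `(1/|u|)^θ |u| Lw ≤ M^θ`
      have e1 : (1 / |u|) ^ θ * (|u| * Lw) ≤ M ^ θ := by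
        have huLw : |u| ≤ 1 / Lw := by rw [le_div_iff₀ hLw0]; exact hcase
        have h1 : (1 / |u|) ^ θ * |u| = |u| ^ (2 / Real.pi) := by
          rw [one_div, Real.inv_rpow hu0.le, ← Real.rpow_neg hu0.le, ← Real.rpow_add_one hu0.ne', hθ]
          norm_num
        have h2 : |u| ^ (2 / Real.pi) ≤ (1 / Lw) ^ (2 / Real.pi) := Real.rpow_le_rpow hu0.le huLw h2π0.le
        have h3 : (1 / Lw) ^ (2 / Real.pi) * Lw = Lw ^ θ := by
          rw [one_div, Real.inv_rpow hLw0.le, ← Real.rpow_neg hLw0.le, ← Real.rpow_add_one hLw0.ne', hθ]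
          congr 1; ring
        calc (1 / |u|) ^ θ * (|u| * Lw) = ((1 / |u|) ^ θ * |u|) * Lw := by ring
          _ = |u| ^ (2 / Real.pi) * Lw := by rw [h1]
          _ ≤ (1 / Lw) ^ (2 / Real.pi) * Lw := mul_le_mul_of_nonneg_right h2 hLw0.le
          _ = Lw ^ θ := h3
          _ ≤ M ^ θ := Real.rpow_le_rpow hLw0.le hLwM hθ0.le
      have e2 : (Real.log ℓ ^ 2) ^ θ * (|u| * Lw) ≤ M ^ θ := by
        calc (Real.log ℓ ^ 2) ^ θ * (|u| * Lw) ≤ (Real.log ℓ ^ 2) ^ θ * 1 :=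
              mul_le_mul_of_nonneg_left hcase (Real.rpow_nonneg (sq_nonneg _) θ)
          _ = (Real.log ℓ ^ 2) ^ θ := mul_one _
          _ ≤ M ^ θ := Real.rpow_le_rpow (sq_nonneg _) hllM hθ0.le
      have htw : ‖1 - (w : ℂ) ^ (-((u : ℂ) * I))‖ ≤ |u| * Lw := htw1.trans (mul_le_mul_of_nonneg_left hlogw (abs_nonneg u))
      calc ‖truncEulerProduct (⇑f) x (1 + (y₀ + u) * I)‖ * ‖1 - (w : ℂ) ^ (-((u : ℂ) * I))‖
          ≤ b * (|u| * Lw) := mul_le_mul hFle htw (norm_nonneg _) hb0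
        _ = Real.sqrt C' * ℓ ^ (2 / Real.pi) * (mx ^ θ * (|u| * Lw)) := by rw [hb]; ring
        _ ≤ Real.sqrt C' * ℓ ^ (2 / Real.pi) * (((1 / |u|) ^ θ + (Real.log ℓ ^ 2) ^ θ) * (|u| * Lw)) := by
            gcongr
        _ = Real.sqrt C' * ℓ ^ (2 / Real.pi) * ((1 / |u|) ^ θ * (|u| * Lw) + (Real.log ℓ ^ 2) ^ θ * (|u| * Lw)) := by
            ring
        _ ≤ Real.sqrt C' * ℓ ^ (2 / Real.pi) * (M ^ θ + M ^ θ) := by gcongr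
        _ = (2 * Real.sqrt C') * ℓ ^ (2 / Real.pi) * M ^ θ := by ring
        _ ≤ K * ℓ ^ (2 / Real.pi) * M ^ θ := by gcongr
    · -- `|u| Lw > 1`: `mx ≤ M` and `|1 - w^{-iu}| ≤ 2`
      push Not at hcase
      have hmxM : mx ≤ M := by
        refine max_le ?_ hllM
        rw [div_le_iff₀ hu0]
        calc 1 ≤ |u| * Lw := hcase.le
          _ ≤ |u| * M := mul_le_mul_of_nonneg_left hLwM (abs_nonneg u)
          _ = M * |u| := mul_comm _ _
      have hmxθ : mx ^ θ ≤ M ^ θ := Real.rpow_le_rpow hmx0.le hmxM hθ0.le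
      calc ‖truncEulerProduct (⇑f) x (1 + (y₀ + u) * I)‖ * ‖1 - (w : ℂ) ^ (-((u : ℂ) * I))‖
          ≤ b * 2 := mul_le_mul hFle htw2 (norm_nonneg _) hb0
        _ = (2 * Real.sqrt C') * ℓ ^ (2 / Real.pi) * mx ^ θ := by rw [hb]; ring
        _ ≤ (2 * Real.sqrt C') * ℓ ^ (2 / Real.pi) * M ^ θ := by gcongr
        _ ≤ K * ℓ ^ (2 / Real.pi) * M ^ θ := by gcongr


/-! ### Elementary inequalities for the final bookkeeping of Theorem 4 -/

/-- The error terms of the twisted inner integral are `≤ 4/α`: for `0 < α ≤ 1`, `ℓ ≥ 2`,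
`m = min(ℓ, 1/α)`, `T = ℓ/2`: `√(m/α) + √m/√T + m²/T ≤ 4/α`. [folklore] -/
theorem err_terms_le {α ℓ : ℝ} (hα : 0 < α) (hα1 : α ≤ 1) (hℓ : 2 ≤ ℓ) :
    Real.sqrt (min ℓ (1 / α) / α) + Real.sqrt (min ℓ (1 / α)) / Real.sqrt (ℓ / 2) +
      (min ℓ (1 / α)) ^ 2 / (ℓ / 2) ≤ 4 / α := by
  set m : ℝ := min ℓ (1 / α) with hm
  have hm0 : 0 ≤ m := le_min (by linarith) (by positivity)
  have hmα : m ≤ 1 / α := min_le_right _ _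
  have hmℓ : m ≤ ℓ := min_le_left _ _
  have hα' : 1 ≤ 1 / α := by rw [le_div_iff₀ hα]; linarith
  have h1 : Real.sqrt (m / α) ≤ 1 / α := by
    rw [Real.sqrt_le_left (by positivity)]
    calc m / α ≤ (1 / α) / α := div_le_div_of_nonneg_right hmα hα.le
      _ = (1 / α) ^ 2 := by ring
  have h2 : Real.sqrt m / Real.sqrt (ℓ / 2) ≤ 1 / α := by
    have hT : 1 ≤ Real.sqrt (ℓ / 2) := by rw [Real.le_sqrt (by norm_num) (by positivity)]; linarith
    calc Real.sqrt m / Real.sqrt (ℓ / 2) ≤ Real.sqrt m := div_le_self (Real.sqrt_nonneg _) hT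
      _ ≤ Real.sqrt (1 / α) := Real.sqrt_le_sqrt hmα
      _ ≤ 1 / α := by
          rw [Real.sqrt_le_left (by positivity)]
          nlinarith
  have h3 : m ^ 2 / (ℓ / 2) ≤ 2 / α := by
    rw [div_le_div_iff₀ (by positivity) hα]
    have : m * m ≤ ℓ * (1 / α) := mul_le_mul hmℓ hmα hm0 (by linarith)
    calc m ^ 2 * α = (m * m) * α := by ring
      _ ≤ (ℓ * (1 / α)) * α := mul_le_mul_of_nonneg_right this hα.le
      _ = 2 * (ℓ / 2) := by field_simp
  calc Real.sqrt (m / α) + Real.sqrt m / Real.sqrt (ℓ / 2) + m ^ 2 / (ℓ / 2) ≤ 1 / α + 1 / α + 2 / α :=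
        add_le_add (add_le_add h1 h2) h3
    _ = 4 / α := by ring

/-- `log(2ℓ)/ℓ ≤ 2 (log ℓ)^{1+2θ}/ℓ^θ` for `ℓ ≥ 3`, `0 ≤ θ ≤ 1`. [folklore] -/
theorem log_two_mul_div_le {ℓ θ : ℝ} (hℓ : 3 ≤ ℓ) (hθ0 : 0 ≤ θ) (hθ1 : θ ≤ 1) :
    Real.log (2 * ℓ) / ℓ ≤ 2 * (Real.log ℓ ^ (1 + 2 * θ) / ℓ ^ θ) := by
  have hℓ0 : 0 < ℓ := by linarith
  have hlogℓ : 1 ≤ Real.log ℓ := by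
    rw [Real.le_log_iff_exp_le hℓ0]; exact le_trans (by have := Real.exp_one_lt_d9; linarith) hℓ
  have hlog2 : Real.log 2 ≤ Real.log ℓ := Real.log_le_log (by norm_num) (by linarith)
  have hnum : Real.log (2 * ℓ) ≤ 2 * Real.log ℓ := by
    rw [Real.log_mul (by norm_num) hℓ0.ne']; linarith
  have hpow : Real.log ℓ ≤ Real.log ℓ ^ (1 + 2 * θ) := by
    calc Real.log ℓ = Real.log ℓ ^ (1 : ℝ) := (Real.rpow_one _).symm
      _ ≤ Real.log ℓ ^ (1 + 2 * θ) := Real.rpow_le_rpow_of_exponent_le hlogℓ (by linarith)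
  have hden : ℓ ^ θ ≤ ℓ := by
    calc ℓ ^ θ ≤ ℓ ^ (1 : ℝ) := Real.rpow_le_rpow_of_exponent_le (by linarith) hθ1
      _ = ℓ := Real.rpow_one _
  have hdenpos : 0 < ℓ ^ θ := Real.rpow_pos_of_pos hℓ0 θ
  calc Real.log (2 * ℓ) / ℓ ≤ 2 * Real.log ℓ / ℓ := div_le_div_of_nonneg_right hnum hℓ0.le
    _ = 2 * (Real.log ℓ / ℓ) := by ring
    _ ≤ 2 * (Real.log ℓ ^ (1 + 2 * θ) / ℓ ^ θ) :=
        mul_le_mul_of_nonneg_left (div_le_div₀ (by positivity) hpow hdenpos hden) (by norm_num)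

/-- `t ≤ t^θ` for `0 ≤ t ≤ 1`, `θ ≤ 1`. [folklore] -/
theorem le_rpow_self_of_le_one {t θ : ℝ} (ht0 : 0 ≤ t) (ht1 : t ≤ 1) (hθ : θ ≤ 1) : t ≤ t ^ θ := by
  rcases ht0.eq_or_lt with h | h
  · rw [← h]
    rcases eq_or_ne θ 0 with h0 | h0
    · rw [h0, Real.rpow_zero]; exact zero_le_one
    · rw [Real.zero_rpow h0]
  · calc t = t ^ (1 : ℝ) := (Real.rpow_one t).symm
      _ ≤ t ^ θ := Real.rpow_le_rpow_of_exponent_ge h ht1 hθ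

/-- `(log ℓ)² ≤ 16 √ℓ` for `ℓ ≥ 1` (from `log ℓ ≤ 4 ℓ^{1/4}`). [folklore] -/
theorem log_sq_le_sqrt {ℓ : ℝ} (hℓ : 1 ≤ ℓ) : Real.log ℓ ^ 2 ≤ 16 * ℓ ^ (1 / 2 : ℝ) := by
  have hℓ0 : 0 < ℓ := by linarith
  have h := Real.log_le_rpow_div hℓ0.le (by norm_num : (0:ℝ) < 1 / 4)
  have h4 : Real.log ℓ ≤ 4 * ℓ ^ (1 / 4 : ℝ) := by linarith
  have h0 : 0 ≤ Real.log ℓ := Real.log_nonneg hℓ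
  calc Real.log ℓ ^ 2 ≤ (4 * ℓ ^ (1 / 4 : ℝ)) ^ 2 := pow_le_pow_left₀ h0 h4 2
    _ = 16 * ((ℓ ^ (1 / 4 : ℝ)) ^ (2:ℕ)) := by ring
    _ = 16 * ℓ ^ (1 / 2 : ℝ) := by
        rw [← Real.rpow_natCast, ← Real.rpow_mul hℓ0.le]; norm_num


/-! ### (6.3): the window bound on `Re s = 1 + α` via (2.6) -/

/-- **GS03 (6.3)**: if `g(n) = f(n) n^{-iy₀}` (`f` multiplicative, `|f| ≤ 1`, `x ≥ 3`, `w ≥ 1`) and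
`|F(1+i(y₀+u))| |1 - w^{-iu}| ≤ A₀` for all `|u| ≤ log x`, then for `α > 0` and `|y| ≤ (log x)/2`,
`|G₀(1+α+iy)(1 - w^{-α-iy})| ≤ A₀ + 8e⁵ α` (`G₀(s) = ∑ g̃(n) n^{-s} = F(s + iy₀)`), by (2.6) with
`T = (log x)/2` and `∑ |g̃(n)|/n ≤ e⁵ log x`. [cite: GranvilleSoundararajan2003, §6, (6.3)] -/
theorem norm_G_twist_window_le (f : ArithmeticFunction ℂ) (hf : f.IsMultiplicative) (hfb : ∀ n, ‖f n‖ ≤ 1)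
    {g : ℕ → ℂ} {y₀ : ℝ} (hg : ∀ n, g n = f n * (n : ℂ) ^ (-(y₀ * I)))
    {x : ℝ} (hx : 3 ≤ x) {w : ℝ} (hw : 1 ≤ w) {A₀ : ℝ}
    (hA₀ : ∀ u : ℝ, |u| ≤ Real.log x →
      ‖truncEulerProduct (⇑f) x (1 + (y₀ + u) * I)‖ * ‖1 - (w : ℂ) ^ (-((u : ℂ) * I))‖ ≤ A₀)
    {α : ℝ} (hα : 0 < α) {y : ℝ} (hy : |y| ≤ Real.log x / 2) :
    ‖LSeries (smoothCut g ⌊x⌋₊) (1 + α + y * I) * (1 - (w : ℂ) ^ (1 - ((1 : ℂ) + α + y * I)))‖ ≤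
      A₀ + 8 * Real.exp 5 * α := by
  have hgb : ∀ n, ‖g n‖ ≤ 1 := norm_twist_fun_le hg hfb
  obtain ⟨hsum, hS⟩ := Halasz.tsum_norm_term_one_le (g := g) hgb hx
  have hℓ0 : 0 < Real.log x := Real.log_pos (by linarith)
  have hT : 0 < Real.log x / 2 := by positivity
  have h26 := norm_LSeries_twist_le_of_bound (α := α) hα (a := smoothCut g ⌊x⌋₊) (σ₀ := 1) hsum hT hw y (B := A₀)
    (fun u hu => by
      have huℓ : |u| ≤ Real.log x := by linarith
      have hre : (0:ℝ) < (1 + (y₀ + u) * I : ℂ).re := by simp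
      have h1 : LSeries (smoothCut g ⌊x⌋₊) (((1 : ℝ) : ℂ) + u * I) = truncEulerProduct (⇑f) x (1 + (y₀ + u) * I) := by
        rw [LSeries_smoothCut_twist hg, truncEulerProduct_eq_LSeries f hf hfb x hre]
        congr 1; push_cast; ring
      rw [norm_mul, h1]
      exact hA₀ u huℓ)
  have htw : (1 : ℂ) - ((1 : ℂ) + α + y * I) = -((α : ℂ) + y * I) := by ring
  rw [htw]
  simp only [Complex.ofReal_one] at h26
  refine h26.trans ?_
  have hS0 : 0 ≤ ∑' n : ℕ, ‖smoothCut g ⌊x⌋₊ n‖ / (n : ℝ) ^ (1 : ℝ) := tsum_nonneg fun n => by positivity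
  have : 4 * α / (Real.log x / 2) * ∑' n : ℕ, ‖smoothCut g ⌊x⌋₊ n‖ / (n : ℝ) ^ (1 : ℝ) ≤ 8 * Real.exp 5 * α := by
    calc 4 * α / (Real.log x / 2) * ∑' n : ℕ, ‖smoothCut g ⌊x⌋₊ n‖ / (n : ℝ) ^ (1 : ℝ)
        ≤ 4 * α / (Real.log x / 2) * (Real.exp 5 * Real.log x) := mul_le_mul_of_nonneg_left hS (by positivity)
      _ = 8 * Real.exp 5 * α := by field_simp; norm_num
  linarith

/-- The trivial bound on `Re s = 1 + α`: `|G(1+α+iy)(1 - w^{1-s})| ≤ 2(1 + 1/α)`.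
[cite: GranvilleSoundararajan2003, §6, (6.5)] -/
theorem norm_G_twist_trivial_le {g : ℕ → ℂ} (hgb : ∀ n, ‖g n‖ ≤ 1) (N : ℕ) {w : ℝ} (hw : 1 ≤ w)
    {α : ℝ} (hα : 0 < α) (y : ℝ) :
    ‖LSeries (smoothCut g N) (1 + α + y * I) * (1 - (w : ℂ) ^ (1 - ((1 : ℂ) + α + y * I)))‖ ≤ 2 + 2 / α := by
  rw [norm_mul]
  have h1 := norm_LSeries_smoothCut_le_one_add_inv hgb N hα y
  have h2 := norm_twist_le_two hw hα.le y
  calc ‖LSeries (smoothCut g N) (1 + α + y * I)‖ * ‖1 - (w : ℂ) ^ (1 - ((1 : ℂ) + α + y * I))‖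
      ≤ (1 + 1 / α) * 2 := mul_le_mul h1 h2 (norm_nonneg _) (by positivity)
    _ = 2 + 2 / α := by ring

/-- `√(m/α) ≤ 1/α` for `m = min(ℓ, 1/α)`, `α > 0`. [folklore] -/
theorem sqrt_min_div_le {α : ℝ} (hα : 0 < α) (ℓ : ℝ) : Real.sqrt (min ℓ (1 / α) / α) ≤ 1 / α := by
  rw [Real.sqrt_le_left (by positivity)]
  calc min ℓ (1 / α) / α ≤ (1 / α) / α := div_le_div_of_nonneg_right (min_le_right _ _) hα.le
    _ = (1 / α) ^ 2 := by ring

/-! ### The reduction: Proposition 3.3 with the window bound, integrated in `α` (§6) -/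

set_option maxHeartbeats 400000 in
/-- **The analytic reduction of Theorem 4** (Proposition 3.3 + (6.2)–(6.5), crude constants): there is
an absolute `C_L` such that for every multiplicative `g` with `|g| ≤ 1`, `x ≥ 9` (`ℓ = log x`),
`1 ≤ w ≤ √x`, and `1 ≤ A ≤ 2ℓ` with `|G(1+α+iy)(1 - w^{-α-iy})| ≤ A` for all `0 < α ≤ 1`, `|y| ≤ ℓ/2`
(`G(s) = ∑ g̃(n) n^{-s}`), one has
`‖S(x) - wS(x/w)‖/x · ℓ ≤ 102 A log(2ℓ/A) + 204 A + C_L (log 2ℓ + log 2w · log(ℓ/log 2w) + log 2w)`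
(Lemma 2.1 (2.2), the kernel step, the twisted (3.8) + Lemma 3.2, and the `α`-integration split at
`α = 1/A` using the trivial bound `2(1+1/α)` beyond it).
[cite: GranvilleSoundararajan2003, Proposition 3.3 and §6, (6.2)–(6.5)] -/
theorem exists_norm_S_sub_le_of_window :
    ∃ C_L : ℝ, 0 ≤ C_L ∧ ∀ (g : ArithmeticFunction ℂ), g.IsMultiplicative → (∀ n, ‖g n‖ ≤ 1) →
      ∀ x : ℝ, 9 ≤ x → ∀ w : ℝ, 1 ≤ w → w ≤ Real.sqrt x → ∀ A : ℝ, 1 ≤ A → A ≤ 2 * Real.log x →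
        (∀ α : ℝ, 0 < α → α ≤ 1 → ∀ y : ℝ, |y| ≤ Real.log x / 2 →
          ‖LSeries (smoothCut (⇑g) ⌊x⌋₊) (1 + α + y * I) * (1 - (w : ℂ) ^ (1 - ((1 : ℂ) + α + y * I)))‖ ≤ A) →
        ‖S (⇑g) x - (w : ℂ) * S (⇑g) (x / w)‖ / x * Real.log x ≤
          102 * A * Real.log (2 * Real.log x / A) + 204 * A +
            C_L * (Real.log (2 * Real.log x) + Real.log (2 * w) * Real.log (Real.log x / Real.log (2 * w)) +
              Real.log (2 * w)) := by
  obtain ⟨CA, hCA0, hA2⟩ := exists_inner_integral_twisted_le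
  obtain ⟨CB, hCB0, h22⟩ := exists_norm_S_sub_mul_log_le_integral
  refine ⟨204 + 136 * CA + 3 + CB, by positivity, ?_⟩
  intro g hg hgb x hx w hw1 hwx A hA1 hAℓ hwin
  set ℓ : ℝ := Real.log x with hℓ
  set N : ℕ := ⌊x⌋₊ with hN
  set Lw : ℝ := Real.log (2 * w) with hLw
  set α₀ : ℝ := 1 / (2 * ℓ) with hα₀
  set αs : ℝ := 1 / A with hαs
  have hx0 : 0 < x := by linarith
  have hx1 : 1 ≤ x := by linarith
  have hx3 : 3 ≤ x := by linarith
  have hw0 : 0 < w := by linarith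
  have hA0 : 0 < A := by linarith
  -- `ℓ ≥ 2`
  have hℓ2 : 2 ≤ ℓ := by
    rw [hℓ, Real.le_log_iff_exp_le hx0]
    have h1 := Real.exp_one_lt_d9
    have h0 : 0 < Real.exp 1 := Real.exp_pos 1
    have : Real.exp 2 = Real.exp 1 * Real.exp 1 := by rw [← Real.exp_add]; norm_num
    rw [this]; nlinarith
  have hℓ0 : 0 < ℓ := by linarith
  have hα₀0 : 0 < α₀ := by positivity
  have hα₀s : α₀ ≤ αs := by
    rw [hα₀, hαs]; exact one_div_le_one_div_of_le hA0 hAℓ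
  have hαs1 : αs ≤ 1 := by rw [hαs, div_le_one hA0]; exact hA1
  have hα₀1 : α₀ ≤ 1 := hα₀s.trans hαs1
  -- `3w ≤ x`, `2w ≤ x`
  have hsx : Real.sqrt x * Real.sqrt x = x := Real.mul_self_sqrt hx0.le
  have h3s : 3 ≤ Real.sqrt x := by
    rw [show (3:ℝ) = Real.sqrt 9 by rw [show (9:ℝ) = 3 ^ 2 by norm_num, Real.sqrt_sq (by norm_num)]]
    exact Real.sqrt_le_sqrt hx
  have h3w : 3 * w ≤ x := by nlinarith [Real.sqrt_nonneg x]
  have h2w : 2 * w ≤ x := by linarith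
  have hLw0 : 0 < Lw := by rw [hLw]; exact Real.log_pos (by linarith)
  -- Step 1: Lemma 2.1 (2.2)
  have h1 := h22 (⇑g) (fun m n hmn => hg.map_mul_of_coprime hmn) hgb x w hw1 h3w
  -- Step 2: the kernel step
  have h2 := integral_normD_le hgb hw1 h2w (f := ⇑g)
  rw [← hℓ, ← hN] at h2
  -- Step 3: the inner integral as a function of `α`
  set Iα : ℝ → ℝ := fun α => ∫ u in Set.Ioc (Real.log (2 * w)) ℓ,
    ‖psum (mulLog (⇑g) N) (Real.exp u) - (w : ℂ) * psum (mulLog (⇑g) N) (Real.exp u / w)‖ *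
      Real.exp (-((1 + 2 * α) * u)) with hIα
  have hIon : IntegrableOn Iα (Set.Ioc α₀ 1) := by
    have hK := (integrable_twisted_kernel (g := ⇑g) hgb N (w := w) hx1 hw1 hα₀0.le).integral_prod_left
    rw [← hℓ] at hK
    exact hK
  have hIint1 : IntervalIntegrable Iα volume α₀ αs := by
    rw [intervalIntegrable_iff_integrableOn_Ioc_of_le hα₀s]
    exact hIon.mono_set (Set.Ioc_subset_Ioc_right hαs1)
  have hIint2 : IntervalIntegrable Iα volume αs 1 := by
    rw [intervalIntegrable_iff_integrableOn_Ioc_of_le hαs1]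
    exact hIon.mono_set (Set.Ioc_subset_Ioc_left hα₀s)
  have hT1 : 1 ≤ ℓ / 2 := by linarith
  -- pointwise bounds
  have hpt1 : ∀ α ∈ Set.Icc α₀ αs, Iα α ≤ (6 * A + 4 * CA) * (1 / α) := by
    intro α hα
    have hαp : 0 < α := hα₀0.trans_le hα.1
    have hα1 : α ≤ 1 := hα.2.trans hαs1
    have h := hA2 g hg hgb x hx3 (ℓ / 2) hT1 α hαp hα1 w hw1 A hA0.le
      (fun y hy => hwin α hαp hα1 y (by rw [hℓ]; exact hy))
    rw [← hℓ, ← hN] at h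
    have he := err_terms_le hαp hα1 hℓ2
    have hs := sqrt_min_div_le hαp ℓ
    have hI : Iα α = ∫ u in Set.Ioc (Real.log (2 * w)) ℓ,
        ‖psum (mulLog (⇑g) N) (Real.exp u) - (w : ℂ) * psum (mulLog (⇑g) N) (Real.exp u / w)‖ *
          Real.exp (-((1 + 2 * α) * u)) := rfl
    rw [hI]
    calc _ ≤ 6 * A * Real.sqrt (min ℓ (1 / α) / α) +
          CA * (Real.sqrt (min ℓ (1 / α) / α) + Real.sqrt (min ℓ (1 / α)) / Real.sqrt (ℓ / 2) +
            (min ℓ (1 / α)) ^ 2 / (ℓ / 2)) := h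
      _ ≤ 6 * A * (1 / α) + CA * (4 / α) := by gcongr
      _ = (6 * A + 4 * CA) * (1 / α) := by ring
  have hpt2 : ∀ α ∈ Set.Icc αs 1, Iα α ≤ (12 + 4 * CA) * (1 / α) + 12 * (1 / α ^ 2) := by
    intro α hα
    have hαp : 0 < α := (by positivity : 0 < αs).trans_le hα.1
    have hα1 : α ≤ 1 := hα.2
    have hB0 : 0 ≤ 2 + 2 / α := by positivity
    have h := hA2 g hg hgb x hx3 (ℓ / 2) hT1 α hαp hα1 w hw1 (2 + 2 / α) hB0
      (fun y _ => norm_G_twist_trivial_le hgb N hw1 hαp y)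
    rw [← hℓ, ← hN] at h
    have he := err_terms_le hαp hα1 hℓ2
    have hs := sqrt_min_div_le hαp ℓ
    have hI : Iα α = ∫ u in Set.Ioc (Real.log (2 * w)) ℓ,
        ‖psum (mulLog (⇑g) N) (Real.exp u) - (w : ℂ) * psum (mulLog (⇑g) N) (Real.exp u / w)‖ *
          Real.exp (-((1 + 2 * α) * u)) := rfl
    rw [hI]
    calc _ ≤ 6 * (2 + 2 / α) * Real.sqrt (min ℓ (1 / α) / α) +
          CA * (Real.sqrt (min ℓ (1 / α) / α) + Real.sqrt (min ℓ (1 / α)) / Real.sqrt (ℓ / 2) +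
            (min ℓ (1 / α)) ^ 2 / (ℓ / 2)) := h
      _ ≤ 6 * (2 + 2 / α) * (1 / α) + CA * (4 / α) := by gcongr
      _ = (12 + 4 * CA) * (1 / α) + 12 * (1 / α ^ 2) := by field_simp; ring
  -- integrate
  have hcont1 : ContinuousOn (fun α : ℝ => (6 * A + 4 * CA) * (1 / α)) (Set.Icc α₀ αs) :=
    continuousOn_const.mul (continuousOn_const.div continuousOn_id fun α hα => (hα₀0.trans_le hα.1).ne')
  have hcont2 : ContinuousOn (fun α : ℝ => (12 + 4 * CA) * (1 / α) + 12 * (1 / α ^ 2)) (Set.Icc αs 1) := by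
    have hαs0 : 0 < αs := by positivity
    refine (continuousOn_const.mul (continuousOn_const.div continuousOn_id fun α hα => (hαs0.trans_le hα.1).ne')).add
      (continuousOn_const.mul (continuousOn_const.div (continuousOn_id.pow 2) fun α hα => ?_))
    exact pow_ne_zero 2 (hαs0.trans_le hα.1).ne'
  have hint1 : ∫ α in α₀..αs, Iα α ≤ (6 * A + 4 * CA) * Real.log (2 * ℓ / A) := by
    calc ∫ α in α₀..αs, Iα α ≤ ∫ α in α₀..αs, (6 * A + 4 * CA) * (1 / α) :=
          intervalIntegral.integral_mono_on hα₀s hIint1 (hcont1.intervalIntegrable_of_Icc hα₀s) hpt1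
      _ = (6 * A + 4 * CA) * Real.log (αs / α₀) := by
          rw [intervalIntegral.integral_const_mul, integral_one_div_of_pos hα₀0 (by positivity)]
      _ = (6 * A + 4 * CA) * Real.log (2 * ℓ / A) := by
          congr 2; rw [hαs, hα₀]; field_simp
  have hint2 : ∫ α in αs..1, Iα α ≤ (12 + 4 * CA) * Real.log A + 12 * (A - 1) := by
    have hαs0 : 0 < αs := by positivity
    have hi1 : IntervalIntegrable (fun α : ℝ => (12 + 4 * CA) * (1 / α)) volume αs 1 :=
      ((continuousOn_const.mul (continuousOn_const.div continuousOn_id fun α hα => (hαs0.trans_le hα.1).ne')).intervalIntegrable_of_Icc hαs1)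
    have hi2 : IntervalIntegrable (fun α : ℝ => 12 * (1 / α ^ 2)) volume αs 1 := by
      refine (continuousOn_const.mul (continuousOn_const.div (continuousOn_id.pow 2) fun α hα => ?_)).intervalIntegrable_of_Icc hαs1
      exact pow_ne_zero 2 (hαs0.trans_le hα.1).ne'
    calc ∫ α in αs..1, Iα α ≤ ∫ α in αs..1, ((12 + 4 * CA) * (1 / α) + 12 * (1 / α ^ 2)) :=
          intervalIntegral.integral_mono_on hαs1 hIint2 (hi1.add hi2) hpt2
      _ = (12 + 4 * CA) * Real.log (1 / αs) + 12 * (1 / αs - 1 / 1) := by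
          rw [intervalIntegral.integral_add hi1 hi2, intervalIntegral.integral_const_mul,
            intervalIntegral.integral_const_mul, integral_one_div_of_pos hαs0 one_pos,
            Halasz.integral_one_div_sq hαs0 hαs1]
      _ = (12 + 4 * CA) * Real.log A + 12 * (A - 1) := by
          rw [hαs]; simp
  -- logarithm bookkeeping
  have hlogA : Real.log A ≤ Real.log (2 * ℓ) := Real.log_le_log hA0 hAℓ
  have hlogA0 : 0 ≤ Real.log A := Real.log_nonneg hA1
  have hlog2ℓA : Real.log (2 * ℓ / A) ≤ Real.log (2 * ℓ) := by
    rw [Real.log_div (by positivity) hA0.ne']; linarith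
  have hlog2ℓA0 : 0 ≤ Real.log (2 * ℓ / A) := Real.log_nonneg (by rw [le_div_iff₀ hA0]; linarith)
  have hlog2ℓ0 : 0 ≤ Real.log (2 * ℓ) := by linarith
  have htot : ∫ α in α₀..1, Iα α ≤ 6 * A * Real.log (2 * ℓ / A) + 12 * A + (12 + 8 * CA) * Real.log (2 * ℓ) := by
    rw [← intervalIntegral.integral_add_adjacent_intervals hIint1 hIint2]
    have e1 : (6 * A + 4 * CA) * Real.log (2 * ℓ / A) ≤ 6 * A * Real.log (2 * ℓ / A) + 4 * CA * Real.log (2 * ℓ) := by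
      nlinarith [mul_le_mul_of_nonneg_left hlog2ℓA (by positivity : 0 ≤ 4 * CA)]
    have e2 : (12 + 4 * CA) * Real.log A ≤ (12 + 4 * CA) * Real.log (2 * ℓ) :=
      mul_le_mul_of_nonneg_left hlogA (by positivity)
    linarith
  -- combine everything
  have hIoc : (∫ α in Set.Ioc (1 / (2 * ℓ)) 1, Iα α) = ∫ α in α₀..1, Iα α := by
    rw [hα₀, intervalIntegral.integral_of_le hα₀1]
  have hker : ∫ u in Real.log (2 * w)..ℓ, ‖S (⇑g) (Real.exp u) - (w : ℂ) * S (⇑g) (Real.exp u / w)‖ * Real.exp (-u) ≤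
      17 * (6 * A * Real.log (2 * ℓ / A) + 12 * A + (12 + 8 * CA) * Real.log (2 * ℓ)) +
        3 * Lw * Real.log (ℓ / Lw) := by
    have h2' : ∫ u in Real.log (2 * w)..ℓ, ‖S (⇑g) (Real.exp u) - (w : ℂ) * S (⇑g) (Real.exp u / w)‖ * Real.exp (-u) ≤
        17 * (∫ α in Set.Ioc (1 / (2 * ℓ)) 1, Iα α) + 3 * Lw * Real.log (ℓ / Lw) := h2
    rw [hIoc] at h2'
    nlinarith
  have hLwlog0 : 0 ≤ Lw * Real.log (ℓ / Lw) := by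
    refine mul_nonneg hLw0.le (Real.log_nonneg ?_)
    rw [le_div_iff₀ hLw0, one_mul, hLw, hℓ]
    exact Real.log_le_log (by linarith) h2w
  rw [← hℓ, ← hLw] at h1
  calc ‖S (⇑g) x - (w : ℂ) * S (⇑g) (x / w)‖ / x * ℓ
      ≤ (∫ u in Real.log (2 * w)..ℓ, ‖S (⇑g) (Real.exp u) - (w : ℂ) * S (⇑g) (Real.exp u / w)‖ * Real.exp (-u)) +
          CB * Lw := h1
    _ ≤ 17 * (6 * A * Real.log (2 * ℓ / A) + 12 * A + (12 + 8 * CA) * Real.log (2 * ℓ)) +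
          3 * Lw * Real.log (ℓ / Lw) + CB * Lw := by linarith
    _ = 102 * A * Real.log (2 * ℓ / A) + 204 * A +
          ((204 + 136 * CA) * Real.log (2 * ℓ) + 3 * (Lw * Real.log (ℓ / Lw)) + CB * Lw) := by ring
    _ ≤ 102 * A * Real.log (2 * ℓ / A) + 204 * A +
          (204 + 136 * CA + 3 + CB) * (Real.log (2 * ℓ) + Lw * Real.log (ℓ / Lw) + Lw) := by
        have hC0 : 0 ≤ 204 + 136 * CA + 3 + CB := by positivity
        nlinarith [mul_nonneg hC0 hlog2ℓ0, mul_nonneg hC0 hLwlog0, mul_nonneg hC0 hLw0.le,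
          mul_nonneg hCA0 hLwlog0, mul_nonneg hCA0 hLw0.le, mul_nonneg hCB0 hlog2ℓ0, mul_nonneg hCB0 hLwlog0]


end GranvilleSoundararajan

end Literature.NumberTheory.LFunctions
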